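import Summits.BirchSwinnertonDyer.BirchSwinnertonDyer.Theorems.KimAtThreeKolyvaginDeepLowerKatoStratum
import Summits.BirchSwinnertonDyer.BirchSwinnertonDyer.Theorems.KimAtThreeKolyvaginDeepLowerOfCertificate
import HarnessLib

/-!
# Crux `DeepLowerAtThree` (item stmt-BirchSwinnertonDyer-19075) in `∂`-CURRENCY on the Kato stratum at `t = 0`,
# GRANTED cell n1011's (a′) typed inputs — route W2 `KimAtThreeKolyvagin`, cell `bsd-addord`, seat kim3 gen 8
# (sequel = step (3) of `KimAtThreeKolyvaginDeepLowerKatoStratum.lean`)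

HONEST FRAMING. Theorems only (no definition, no named fact, no `sorry`); nothing asserted, nothing booked, no
mark moved; crux 19075 stays OPEN.  CONDITIONAL on: the two [S24] Thm. 4.4 (1)(2) facts `hS24`/`hS24₂` (typed
weaker than print, PUB), GZK `hGZK` (PUB), the Poitou–Tate families `inv`/`inv′` (data binders), ONE repaired
dictionary port `KatoKuriharaPortThreeAtWith₂ W 0 v₃ η D` (FLAG `K22-Thm3.13-PORT@3`: Kim's refined explicit
reciprocity law at an additive `3`, NOT in print at `3`; = memo kim3/KIM3-PROOF.md §4 Prop. D, REF PASS; kernel-open —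
the SAME debt crux 19076 `DeepUpperAtThree` carries).  Tate's `hEP` is discharged by name; the Manin datum is
`3 ∤ c_D` + the period transfer (or optimality).

WHAT.  `deepLower_datum_of_ports` / `deepLower_optimal_of_ports`: for the newform `D.f` of a parametrisation datum
`D` AT THE CONDUCTOR of a row {`3`-adic tower onto, ADDITIVE at `3` with `3 ∤ c₃`, `E(ℚ₃)[3] = 0`, `ord(δ̃) = 0`,
`3 ∤ c_D` + period transfer (resp. optimal)} — `∂^{(∞)}_deep(δ̃) = d ∈ ℕ` and `∂⁽⁰⁾(δ̃) ≤ ord₃ #Ш(E/ℚ)(3) + d`,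
i.e. the conclusion of crux 19075, from step (2) of the prequel (Cor C-t at `t = 0`, every depth, any
certificate) through gen 7's dictionary `deepLower_conclusion_iff_eventuallyDivisible` (p415298) and reverse
bridge `kuriharaPartial_zero_le_natCast_of_padicValRat_le` (p415993).  Effect: on the `3 ∤ c₃ ∧ t = 0` stratum
the `@[conjecture]` NAME `N11.KimAtThreeDeepCertPUB` of gen 7's `deepLower_optimal_of_kimAtThreeDeepCertPUB` is
replaced by n1011's port-facts.  NOT COVERED: `3 ∣ c₃`, `t ≥ 1`, non-additive `3`, a newform not carried by a
datum at the conductor.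
References: [Kim2025RefinedTNC] Thm 1.1; [Kim2022StructureSelmer] Thm. 1.9 (6), 3.13; [Sakamoto2024] Thm. 4.4;
[MazurRubin2004] Thm. 5.2.12; memo `run/shared/lean/pub/bsd-addord/kim3/KIM3-PROOF.md` §16 (Cor C-t).
-/

set_option autoImplicit false
-- the Theorems namespace of a single-conjunct summit repeats the summit name by design (D-0017)
set_option linter.dupNamespace false

noncomputable section

open scoped Classical NumberField ContRepresentation
open Function Field NumberField IsDedekindDomain IsDedekindDomain.HeightOneSpectrum WeierstrassCurve
  CongruenceSubgroup
  Literature.NumberTheory.EllipticCurves Literature.NumberTheory.EllipticCurves.ModularForms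
  Literature.NumberTheory.EllipticCurves.Rank1Residual
  Literature.NumberTheory.GaloisRepresentations
  Literature.NumberTheory.GaloisRepresentations.DiscreteGaloisModule Literature.NumberTheory.GaloisCohomology
  Rat.HeightOneSpectrum
  Summit.BirchSwinnertonDyer.Rank1Residual.GaloisImage
  Summit.BirchSwinnertonDyer.Rank1Residual.GaloisImage.Assembly
  Summit.BirchSwinnertonDyer.Rank1Residual.X4
  Summit.BirchSwinnertonDyer.BirchSwinnertonDyer.Theorems.KimAtThreeKolyvaginUnitLevelOneRungs
  Summit.BirchSwinnertonDyer.BirchSwinnertonDyer.Theorems.KimAtThreeKolyvaginCertificateDictionary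
  Summit.BirchSwinnertonDyer.BirchSwinnertonDyer.Theorems.KimAtThreeKolyvaginDeepLowerOfCertificate
  Summit.BirchSwinnertonDyer.BirchSwinnertonDyer.Theorems.KimAtThreeKolyvaginDeepLowerKatoStratum

namespace Summit.BirchSwinnertonDyer.BirchSwinnertonDyer.Theorems.KimAtThreeKolyvaginDeepLowerKatoStratumPartial


/-- **GRANTED n1011's (a′) inputs at `t = 0`, the conclusion of crux `DeepLowerAtThree` holds for the
newform `D.f` of every parametrisation datum `D` AT THE CONDUCTOR (`N = N_E`) of a row {`3`-adic tower onto,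
ADDITIVE at `3` with `3 ∤ c₃`, `E(ℚ₃)[3] = 0`, `ord(δ̃) = 0`, `3 ∤ c_D`, period transfer
`Ω(W) = u·Ω⁺_{D.f}`, `|u|₃ = 1`}: `∂^{(∞)}_deep(δ̃) = d ∈ ℕ` and `∂⁽⁰⁾(δ̃) ≤ ord₃ #Ш(E/ℚ)(3) + d`.**  Proof:
`deepLower_conclusion_iff_eventuallyDivisible` (⇐) with depth threshold `j + 1`: a certificate of depth `j + 1`
at a cyclic `n ∈ 𝒩_{j+1}` is an explicit `δ̃^{(k′)}_n(ψ) ≠ 0` with `1 ≤ k′ ≤ j + 1`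
(`exists_kuriharaNumber_ne_zero_of_not_kuriharaDivisibleAt`); step (2) at shallow depth `k = j` gives
`ord₃(L(E,1)/Ω(W)) ≤ ord₃ #Ш(3) + (k′ − 1) ≤ ord₃ #Ш(3) + j`, and the reverse bridge turns it into
`∂⁽⁰⁾ ≤ ord₃ #Ш(3) + j`, contradicting `ord₃ #Ш(3) + j < ∂⁽⁰⁾`; `ℓ ∤ N_E` for the primes of `n` by
`Kato.IsKolyvaginPrime.not_dvd_conductorNorm`.  The inputs: `hS24`/`hS24₂` ([S24] Thm. 4.4 (1)(2), typed),
`hGZK`, the Poitou–Tate families, ONE repaired port `KatoKuriharaPortThreeAtWith₂ W 0 v₃ η D` (FLAG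
`K22-Thm3.13-PORT@3`, NOT in print at `3`).  The crux stays open; nothing asserted.
[cite: Kim2025RefinedTNC, Thm 1.1] [cite: Kim2022StructureSelmer, Thm. 1.9 (6), §1.5.1] [cite: Sakamoto2024, Thm. 4.4 (p. 926)]
[cite: MazurRubin2004, Thm. 5.2.12] -/
theorem deepLower_datum_of_ports
    (hS24 : Sakamoto2024.kolyvaginSystems_freeRankOne_zmod_three_pow)
    (hS24₂ : Sakamoto2024.kolyvaginSystems_idealOfBasis_eq_fittingIdeal_zmod_three_pow)
    (hGZK : rank_eq_analyticRank_of_analyticRank_le_one)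
    (W : WeierstrassCurve ℚ) [W.IsElliptic] [W.IsGloballyMinimal]
    (hadd : haveI : Fact (Nat.Prime 3) := ⟨Nat.prime_three⟩; Addv W 3)
    (hc3 : ¬ 3 ∣ (W.baseChange ℚ_[3]).localTamagawaNumber ℤ_[3])
    (htower : ∀ m : ℕ, W.HasSurjectiveModNGaloisRep (3 ^ m : ℕ))
    (ht0 : Nat.card {Q : (W.baseChange ℚ_[3]).toAffine.Point // (3 : ℕ) • Q = 0} = 1)
    {N : ℕ} [NeZero N] (hN : N = W.conductorNorm ℤ) (D : ModularParametrizationData W N)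
    (hcD : ¬ (3 : ℤ) ∣ D.maninConstant)
    (hper : ∃ u : ℚ, ‖(u : ℚ_[3])‖ = 1 ∧ W.realPeriodRat = u * plusPeriod D.f)
    (inv : LocalInvariants ℚ 3) (hperf : inv.IsPerfect) (hsum : inv.SumLocalTermEqZero)
    (hcompl : inv.SelmerComplement)
    (inv' : ∀ k' : ℕ, LocalInvariants ℚ (3 ^ (k' + 1))) (hperf' : ∀ k', (inv' k').IsPerfect)
    (hsum' : ∀ k', (inv' k').SumLocalTermEqZero) (hcompl' : ∀ k', (inv' k').SelmerComplement)
    (hinj' : ∀ k', ∀ v : HeightOneSpectrum (𝓞 ℚ), Injective (inv' k' (Sum.inr v)))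
    (v₃ : HeightOneSpectrum (𝓞 ℚ)) (hv₃ : ((3 : ℕ) : 𝓞 ℚ) ∈ v₃.asIdeal)
    (η : (q : HeightOneSpectrum (𝓞 ℚ)) → (ZMod (Ideal.absNorm q.asIdeal))ˣ)
    (hη : ∀ q : HeightOneSpectrum (𝓞 ℚ), Subgroup.zpowers (η q) = ⊤)
    (hPort : KatoKuriharaPortThreeAtWith₂ W 0 v₃ η D)
    (hord : kuriharaVanishingOrder W 3 D.f = 0) :
    ∃ d : ℕ, kuriharaPartialDeepInfty W 3 D.f = d ∧
      kuriharaPartial W 3 D.f 0 ≤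
        ((padicValNat 3 (Nat.card (AddCommGroup.primaryComponent W.sha 3)) + d : ℕ) : ℕ∞) := by
  haveI : Fact (Nat.Prime 3) := ⟨Nat.prime_three⟩
  set s := padicValNat 3 (Nat.card (AddCommGroup.primaryComponent W.sha 3)) with hs
  have hirr : W.HasIrreducibleModPGaloisRep 3 :=
    hasIrreducibleModPGaloisRep_of_hasSurjectiveModNGaloisRep W 3 (by simpa using htower 1)
  have h0 : ratPlusSymbol D.f 0 ≠ 0 :=
    ratPlusSymbol_zero_ne_zero_of_kuriharaVanishingOrder_eq_zero W 3 D.f hord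
  have hL : W.entireLFunction 1 ≠ 0 :=
    D.isNewformOf.entireLFunction_one_ne_zero_of_ratPlusSymbol_zero_ne_zero h0
  have hfin0 : kuriharaPartial W 3 D.f 0 < ⊤ := by
    rw [kuriharaPartial_zero]
    exact kuriharaDivIndex_one_lt_top_of_kuriharaVanishingOrder_eq_zero W 3 D.f hord
  obtain ⟨a, ha⟩ : ∃ a : ℕ, kuriharaPartial W 3 D.f 0 = a :=
    (ENat.ne_top_iff_exists.mp hfin0.ne).imp fun a h => h.symm
  refine (deepLower_conclusion_iff_eventuallyDivisible W 3 D.f ha s).mpr ⟨?_, fun i j hj => ?_⟩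
  · exact lt_of_le_of_lt (kuriharaPartialDeepInfty_le_kuriharaPartial_zero W 3 D.f) hfin0
  · refine ⟨j + 1, fun n hn hkn _ => ?_⟩
    by_contra hcert
    obtain ⟨k', hk'1, hk'j, hk', ψ, hψ, hne⟩ :=
      exists_kuriharaNumber_ne_zero_of_not_kuriharaDivisibleAt W 3 D.f hcert
    haveI : NeZero n := ⟨hkn.ne_zero⟩
    obtain ⟨q, hq, hle⟩ :=
      exists_LOmega_padicValRat_le_of_towerSurj_with_depth_of_anyCertificate hS24 hS24₂ hGZK W hadd hc3
        htower ht0 hL D hcD hper inv hperf hsum hcompl inv' hperf' hsum' hcompl' hinj' v₃ hv₃ η hη hPort j n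
        hkn (fun ℓ _ hℓ => hn.2 ℓ hℓ)
        (fun ℓ hℓ hℓN => (hkn.2 ℓ hℓ).not_dvd_conductorNorm (hN ▸ hℓN)) (j := k') (by omega) ψ hψ hne
    have hle' : padicValRat 3 q ≤ ((s + j : ℕ) : ℤ) := by
      have : ((k' - 1 : ℕ) : ℤ) ≤ (j : ℤ) := by exact_mod_cast (show k' - 1 ≤ j by omega)
      push_cast at hle ⊢
      linarith
    have h' := kuriharaPartial_zero_le_natCast_of_padicValRat_le W 3 D.f (by norm_num) hirr
      D.isNewformOf h0 hper hq hle'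
    rw [ha] at h'
    have h'' : a ≤ s + j := by exact_mod_cast h'
    omega

/-- **The same with the period transfer DISCHARGED by optimality** (`X4.periodTransfer_of_optimal`: for an
OPTIMAL datum — every Néron lattice point is `c_D` times a period of `D.f` — with `3 ∤ c_D`,
`Ω(W) = |c_D|·Ω⁺_{D.f}`): GRANTED n1011's (a′) inputs at `t = 0`, crux `DeepLowerAtThree` holds for the newform of
every optimal datum at the conductor on the stratum {tower, additive `3`, `3 ∤ c₃`, `E(ℚ₃)[3] = 0`, `3 ∤ c_D`}.
[cite: Kim2025RefinedTNC, Thm 1.1] [cite: CremonaAlgorithms1997, §2.8 (p. 26)] [cite: Sakamoto2024, Thm. 4.4 (p. 926)] -/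
theorem deepLower_optimal_of_ports
    (hS24 : Sakamoto2024.kolyvaginSystems_freeRankOne_zmod_three_pow)
    (hS24₂ : Sakamoto2024.kolyvaginSystems_idealOfBasis_eq_fittingIdeal_zmod_three_pow)
    (hGZK : rank_eq_analyticRank_of_analyticRank_le_one)
    (W : WeierstrassCurve ℚ) [W.IsElliptic] [W.IsGloballyMinimal]
    (hadd : haveI : Fact (Nat.Prime 3) := ⟨Nat.prime_three⟩; Addv W 3)
    (hc3 : ¬ 3 ∣ (W.baseChange ℚ_[3]).localTamagawaNumber ℤ_[3])
    (htower : ∀ m : ℕ, W.HasSurjectiveModNGaloisRep (3 ^ m : ℕ))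
    (ht0 : Nat.card {Q : (W.baseChange ℚ_[3]).toAffine.Point // (3 : ℕ) • Q = 0} = 1)
    {N : ℕ} [NeZero N] (hN : N = W.conductorNorm ℤ) (D : ModularParametrizationData W N)
    (hopt : ∀ z ∈ D.L.lattice, ∃ w ∈ periodLattice D.f, z = D.c * w)
    (hcD : ¬ (3 : ℤ) ∣ D.maninConstant)
    (inv : LocalInvariants ℚ 3) (hperf : inv.IsPerfect) (hsum : inv.SumLocalTermEqZero)
    (hcompl : inv.SelmerComplement)
    (inv' : ∀ k' : ℕ, LocalInvariants ℚ (3 ^ (k' + 1))) (hperf' : ∀ k', (inv' k').IsPerfect)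
    (hsum' : ∀ k', (inv' k').SumLocalTermEqZero) (hcompl' : ∀ k', (inv' k').SelmerComplement)
    (hinj' : ∀ k', ∀ v : HeightOneSpectrum (𝓞 ℚ), Injective (inv' k' (Sum.inr v)))
    (v₃ : HeightOneSpectrum (𝓞 ℚ)) (hv₃ : ((3 : ℕ) : 𝓞 ℚ) ∈ v₃.asIdeal)
    (η : (q : HeightOneSpectrum (𝓞 ℚ)) → (ZMod (Ideal.absNorm q.asIdeal))ˣ)
    (hη : ∀ q : HeightOneSpectrum (𝓞 ℚ), Subgroup.zpowers (η q) = ⊤)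
    (hPort : KatoKuriharaPortThreeAtWith₂ W 0 v₃ η D)
    (hord : kuriharaVanishingOrder W 3 D.f = 0) :
    ∃ d : ℕ, kuriharaPartialDeepInfty W 3 D.f = d ∧
      kuriharaPartial W 3 D.f 0 ≤
        ((padicValNat 3 (Nat.card (AddCommGroup.primaryComponent W.sha 3)) + d : ℕ) : ℕ∞) :=
  haveI : Fact (Nat.Prime 3) := ⟨Nat.prime_three⟩
  deepLower_datum_of_ports hS24 hS24₂ hGZK W hadd hc3 htower ht0 hN D hcD
    (periodTransfer_of_optimal 3 D hopt hcD) inv hperf hsum hcompl inv' hperf' hsum' hcompl' hinj' v₃ hv₃ η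
    hη hPort hord

end Summit.BirchSwinnertonDyer.BirchSwinnertonDyer.Theorems.KimAtThreeKolyvaginDeepLowerKatoStratumPartial

end
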